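import Summits.AtomisticToContinuum.HydrodynamicLimit.Theses.JParityClosure
import Literature.MathematicalPhysics.KineticTheory.HardSphereEulerLLN
import Literature.Analysis.FluidPDE.HardSphereAlexander
import Literature.Analysis.FluidPDE.HardSphereRegularGeometry
import Literature.Analysis.FluidPDE.ConfinedHardSphereFlowShortBad

/-!
# Disproof of `RateFloor` (stmt-AtomisticToContinuum-13080, route JParityClosure) — findings

**Verdict after cycle 1 (Lean + literature + EDMD panel): NO KILL.  The crux resists every cheap attack; the reasons are recorded below
as checked lemmas where they can be, and as docstrings where they cannot (they concern the N → ∞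
collision statistics of the deterministic flow, for which nothing is provable today in either direction).**

`RateFloor` (informal): `∃ g₀ > 0` such that for local-Gibbs data at small reduced density `σ < σ₀(profiles)`,
along the hard-sphere flow, for every continuous weight `χ ≥ 0` and every bounded continuous mark `Ξ ≥ 0`
of `(n̂, v⁻, w⁻)`, the normalised collision functional `K_N[χ Ξ] = (ε/(N+1)) Σ_{collisions ≤ τ} Σ_{ordered contact pairs} χ Ξ`
is, with probability `≥ 1 - δ`, at least `g₀ σ³ ∫₀^τ∫ χ B^Ξ_r dx ds − η`, where `B^Ξ_r` is the `r`-mollified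
ideal-gas pair functional of the empirical measure (`N → ∞` at fixed `r`, then `r → 0` is never taken: `r₀` is
chosen after everything but `N`).

## Index of findings

* §1 `conventions` — the only candidate for a cheap ORIENTATION kill is dead: the collision side evaluates the
  mark at the PRE-collisional pair (`pv_eq_precollisional`), which is incoming, i.e. lies exactly on the
  hemisphere `{(w − v)·n̂ > 0}` that the B-side kernel `hardSphereKernel (w, v) n̂ = ((w − v)·n̂)₊` weights
  (`hardSphereKernel_swap_pos_iff`, `collisionMark_mem_kernelHemisphere`); the `(j,i)` term is the `(i,j)` term
  seen through `(n̂,v,w) ↦ (−n̂,w,v)`, under which both sides are invariant (`reflectVel_neg`, `reflectVel_swap`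
  from the tree).  Normalisations match: `K_N[1] → σ³·Y·π∫∫|v−w| μ̄μ̄` versus `σ³ ∫ B¹ = σ³ π ∫∫|v−w| μ̄_r μ̄_r`
  (`(N+1)ε³ = σ³` is `succ_mul_hsDiameter_pow_three`; `∫_{S²}(g·ω)₊dω = π|g|`; `∫ bx = 1`), so the predicted
  ratio is the Enskog contact value `Y(ρσ³) ≥ 1` for EVERY mark, and any `g₀ < 1` is predicted safe.
* §2 `positivity` — `K_N[χΞ] ≥ 0` pathwise (`Kc_nonneg`), so the deviation event is EMPTY as soon as
  `g₀σ³∫χB ≤ η` (`event_empty_of_rhs_le`): every attack through marks of small ideal weight (velocity tails,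
  near-grazing geometries, rare impact parameters, tiny `τ`, `χ` concentrated anywhere) is absorbed by the
  additive slack `η`; only an `O(1)`-weight class of pairs whose collisions are suppressed by an `O(1)` FACTOR
  uniformly in `N` could refute, and in (local) equilibrium the pre-collisional contact law is exactly
  `Y·f⊗f` on the incoming hemisphere (static Gibbs factorisation), with non-equilibrium corrections `O(Kn)`,
  `Kn ≍ (N+1)^{-1/3} → 0` here.
* §3 `load-bearing hypotheses` —
  - `0 < η`: PROVABLY load-bearing (`rateFloor_false_without_etaPos`: with `η = −1`, `χ = Ξ = 0` the event is
    everything; uses Alexander's theorem `HardSphereFlow.nonempty_torus_holds` to inhabit the flow family and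
    `isProbabilityMeasure_localGibbsLaw`).
  - `0 ≤ χ`, `0 ≤ Ξ`: load-bearing ON PAPER only — with a sign-changing mark the one-sided floor becomes a
    two-sided rate identity for the negative part, false whenever the true rate (`Y ×` ideal) differs from
    `g₀ ×` ideal; not Lean-provable without the (open) collision-rate law of large numbers.
  - `∃ C, Ξ ≤ C` and `Continuous Ξ/χ`: NOT needed for the finite-`N` quantities to make sense (all sums are
    finite, `Θ^Ξ` is an integral of a continuous function on a compact sphere); they serve tightness /
    Portmanteau in the limit only — "possibly unnecessary" as far as a refuter can see.
  - `0 < τ`: decoration (for `τ ≤ 0` both sides vanish and the event is empty).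
  - quantifier ORDER `∃ r₀ ∀ r < r₀ ∃ N₀ ∀ N ≥ N₀`: essential and correctly filed.  With `r₀` allowed to depend
    on `N` the statement is junk-TRUE: on the hard-sphere domain `B^Ξ_r ≡ 0` once `2r < ε_N` (two distinct
    centres are `≥ ε_N` apart, so no two lie within `r` of the same `x₀`, and the diagonal carries
    `Θ^Ξ(v,v) = 0`) — §4 PROVES the order-swapped variant `RateFloorRAfterN` outright
    (`rateFloorRAfterN_holds`, via `bxProd_eq_zero_of_sep`, `integral_prod_empiricalMeasure_eq_zero`, the
    flow's null bad set and absolute continuity of the local Gibbs law): any purported proof of `RateFloor`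
    that never uses `ε_N < 2r` proves too much.
* §4 `natural strengthenings` (paper): `g₀ ≥ 1` is NOT claimed and would be false in the dilute limit only
  marginally (`Y → 1⁺`); `g₀ > Y(η₀)`-type strengthenings are false by the same Enskog asymptotics; a
  velocity-dependent floor `g₀(|g|, n̂)` (planner's fallback) is weaker than what is filed and not needed by
  anything we found.
* §5 `computation` — EDMD panel `j009144` + follow-up `j013767` (48 runs, 2.3 M collisions, N = 2000–6000, φ ∈ {0.05, 0.2}, equilibrium /
  shear / temperature / colliding-stream local-Gibbs data): the ratio `R = K_N[Ξ_{kl}] / (σ³∫B^{Ξ_{kl}})` is FLAT in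
  relative speed and impact angle and equals `Y(φ)` up to the positive `O((ε/r)³)` mollifier-hole bias in every run;
  slow pairs and grazing geometries collide at the full Enskog rate; worst bin anywhere `R/Y = 0.97` (equilibrium,
  noise).  No screening; `g₀ = 1/2` has a factor-2 margin everywhere.  Details in the §5 log at the bottom.

Nothing in this file is sorried except where marked NEAR-MISS.
-/

noncomputable section

open MeasureTheory Filter Set Topology
open scoped ENNReal InnerProductSpace RealInnerProductSpace BigOperators
open Literature.MathematicalPhysics.KineticTheory Literature.Analysis.FluidPDE

namespace Summit.AtomisticToContinuum.HydrodynamicLimit.Cruxes.RateFloor.Disproof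

/-! ## §1 Conventions: no orientation / normalisation kill -/

/-- The B-side kernel `hardSphereKernel (w, v) ω = ((w - v)·ω)₊` is positive exactly on the INCOMING
hemisphere `⟪ω, v - w⟫ < 0` of the pair `(v, w)` with impact direction `ω` (the tree's `IsIncoming` is
`⟪x_i - x_j, v_i - v_j⟫ < 0`). [folklore] -/
theorem hardSphereKernel_swap_pos_iff (v w : V3) (ω : Metric.sphere (0 : V3) 1) :
    0 < hardSphereKernel (w, v) ω ↔ ⟪(ω : V3), v - w⟫_ℝ < 0 := by
  rw [hardSphereKernel, lt_max_iff, lt_self_iff_false, or_false, ← neg_sub v w, inner_neg_left,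
    neg_pos, real_inner_comm]

/-- The diagonal carries no weight: `hardSphereKernel (v, v) ω = 0`, so the `i = j` atoms of the product
empirical measure contribute nothing to `B^Ξ_r`. [folklore] -/
theorem hardSphereKernel_self (v : V3) (ω : Metric.sphere (0 : V3) 1) : hardSphereKernel (v, v) ω = 0 := by
  simp [hardSphereKernel]

/-- At a collision the trajectory is right-continuous: `γ s = collidePair G i j zl` with `zl` the
pre-collisional left limit.  The crux's `pv` (reflect the CURRENT velocities across the CURRENT separation
vector) therefore returns exactly the pre-collisional pair `((zl i).2, (zl j).2)` — positions do not move in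
a collision and `reflectVel n` is an involution. [folklore] -/
theorem pv_eq_precollisional {N : ℕ} {X : Type*} (G : Geometry (Fin 3) X) {i j : Fin N} (hij : i ≠ j)
    (zl : Config N (Fin 3) X) :
    reflectVel (G.sepVec (collidePair G i j zl i).1 (collidePair G i j zl j).1)
        ((collidePair G i j zl i).2, (collidePair G i j zl j).2) = ((zl i).2, (zl j).2) := by
  rw [collidePair_apply_fst, collidePair_apply_fst, collidePair_apply_left hij, collidePair_apply_right]
  exact reflectVel_reflectVel _ _

/-- Consequently the collision-side mark of the ordered pair `(i, j)` is evaluated at a point of the SAME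
hemisphere the B-side kernel weights: if the left limit is incoming (`⟪x_i - x_j, v_i⁻ - v_j⁻⟫ < 0`, as the
`binary` field of `IsHardSphereTrajectory` guarantees) then `((w⁻ - v⁻)·n̂)₊ > 0` at
`n̂ = ε⁻¹(x_i - x_j)`, `(v⁻, w⁻) = pv`.  No "wrong-hemisphere mark" makes `K_N` vanish while `B` stays
positive. [folklore] -/
theorem collisionMark_mem_kernelHemisphere {N : ℕ} {X : Type*} (G : Geometry (Fin 3) X) {i j : Fin N}
    (hij : i ≠ j) (zl : Config N (Fin 3) X) (hin : IsIncoming G zl i j) {ε : ℝ} (hε : 0 < ε) :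
    0 < max ⟪(reflectVel (G.sepVec (collidePair G i j zl i).1 (collidePair G i j zl j).1)
        ((collidePair G i j zl i).2, (collidePair G i j zl j).2)).2 -
      (reflectVel (G.sepVec (collidePair G i j zl i).1 (collidePair G i j zl j).1)
        ((collidePair G i j zl i).2, (collidePair G i j zl j).2)).1,
      ε⁻¹ • G.sepVec (collidePair G i j zl i).1 (collidePair G i j zl j).1⟫_ℝ 0 := by
  rw [pv_eq_precollisional G hij zl, collidePair_apply_fst, collidePair_apply_fst]
  refine lt_max_of_lt_left ?_
  rw [inner_smul_right, ← neg_sub (zl i).2 (zl j).2, inner_neg_left, real_inner_comm]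
  exact mul_pos (inv_pos.2 hε) (neg_pos.2 hin)

/-- The `(j, i)` term of the ordered double sum is the `(i, j)` term seen through
`(n̂, v, w) ↦ (−n̂, w, v)`: the separation vector flips sign and `reflectVel` is even in `n` and
swap-equivariant, so `pv j i = ((pv i j).2, (pv i j).1)`.  Both sides of `RateFloor` are invariant under
this involution of the mark, so no asymmetric-mark kill exists either. [folklore] -/
theorem pv_swap (n : V3) (v w : V3) :
    reflectVel (-n) (w, v) = ((reflectVel n (v, w)).2, (reflectVel n (v, w)).1) := by
  rw [reflectVel_neg]
  exact reflectVel_swap n (v, w)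

/-! ## §2 Positivity structure: the additive slack `η` absorbs every small-weight mark -/

/-- `K_N[χ Ξ] ≥ 0` pathwise for nonnegative integrands: the crux's collision functional is
`ε/(N+1)` times a `finsum` over collision times of finite double sums of `if … then χ·Ξ else 0`. [folklore] -/
theorem Kc_nonneg {N : ℕ} (S : Set ℝ) {c : ℝ} (hc : 0 ≤ c) (P : ℝ → Fin N → Fin N → Prop)
    [∀ s i j, Decidable (P s i j)] (F : ℝ → Fin N → Fin N → ℝ) (hF : ∀ s i j, 0 ≤ F s i j) :
    0 ≤ c * ∑ᶠ (s : ℝ) (_ : s ∈ S), ∑ i, ∑ j, (if P s i j then F s i j else 0) :=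
  mul_nonneg hc (finsum_nonneg fun s => finsum_nonneg fun _ =>
    Finset.sum_nonneg fun i _ => Finset.sum_nonneg fun j _ => by
      split_ifs
      · exact hF s i j
      · exact le_rfl)

/-- Hence the deviation event `{K < g₀σ³∫χB − η}` is EMPTY whenever `g₀σ³∫χB ≤ η`: marks whose ideal weight is
below `η/(g₀σ³)` (velocity tails, near-grazing impact, short windows, …) can never witness a violation,
whatever the dynamics does. [folklore] -/
theorem event_empty_of_rhs_le {K A η : ℝ} (hK : 0 ≤ K) (hA : A ≤ η) : ¬ K < A - η := by
  intro h; linarith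

/-! ## §3 Load-bearing hypotheses -/

/-- `RateFloor` with the hypothesis `0 < η` DELETED (everything else verbatim). [folklore] -/
def RateFloorWithoutEtaPos : Prop :=
  ∃ g₀ : ℝ, 0 < g₀ ∧ ∀ (a₀ θ₀ : Literature.MathematicalPhysics.KineticTheory.T3 → ℝ) (u₀ : Literature.MathematicalPhysics.KineticTheory.T3 → Literature.MathematicalPhysics.KineticTheory.V3), Continuous a₀ → Continuous θ₀ → Continuous u₀ → (∀ x, 0 < a₀ x) → (∀ x, 0 < θ₀ x) → ∃ σ₀ : ℝ, 0 < σ₀ ∧ ∀ σ : ℝ, 0 < σ → σ < σ₀ → ∀ Φ : (N : ℕ) → Literature.Analysis.FluidPDE.HardSphereFlow (Literature.Analysis.FluidPDE.Torus.geometry (Fin 3)) (Literature.MathematicalPhysics.KineticTheory.hsDiameter σ N) (N + 1), ∀ τ : ℝ, 0 < τ → ∀ χ : ℝ × UnitAddTorus (Fin 3) → ℝ, Continuous χ → (∀ p, 0 ≤ χ p) → ∀ Ξ : EuclideanSpace ℝ (Fin 3) × EuclideanSpace ℝ (Fin 3) × EuclideanSpace ℝ (Fin 3) → ℝ, Continuous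 Ξ → (∀ q, 0 ≤ Ξ q) → (∃ C : ℝ, ∀ q, Ξ q ≤ C) → ∀ η δ : ℝ, 0 < δ → ∃ r₀ : ℝ, 0 < r₀ ∧ ∀ r : ℝ, 0 < r → r < r₀ → ∃ N₀ : ℕ, ∀ N : ℕ, N₀ ≤ N → let ε := Literature.MathematicalPhysics.KineticTheory.hsDiameter σ N; let G := Literature.Analysis.FluidPDE.Torus.geometry (Fin 3); let γ := fun z (s : ℝ) => (Φ N).flow s z; let bx : UnitAddTorus (Fin 3) → UnitAddTorus (Fin 3) → ℝ := fun x y => 3 / (Real.pi * r ^ 3) * max (1 - Literature.Analysis.FluidPDE.Torus.euclidDist x y / r) 0; let Θ := fun (Ξ : EuclideanSpace ℝ (Fin 3) × EuclideanSpace ℝ (Fin 3) × EuclideanSpace ℝ (Fin 3) → ℝ) (v w : EuclideanSpace ℝ (Fin 3)) => ∫ ω : Metric.sphere (0 : EuclideanSpace ℝ (Fin 3)) 1, Ξ ((ω : EuclideanSpace ℝ (Fin 3)), v, w) * Literature.MathematicalPhysics.KineticTheory.hardSphereKernel (w, v) ω ∂Literature.MathematicalPhysics.KineticTheory.sphereMeasure;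 let B := fun Ξ z s (x₀ : UnitAddTorus (Fin 3)) => ∫ p, bx p.1.1 x₀ * bx p.2.1 x₀ * Θ Ξ p.1.2 p.2.2 ∂((Literature.Analysis.FluidPDE.empiricalMeasure (γ z s)).prod (Literature.Analysis.FluidPDE.empiricalMeasure (γ z s))); let pv := fun z s (i j : Fin (N + 1)) => Literature.Analysis.FluidPDE.reflectVel (G.sepVec (γ z s i).1 (γ z s j).1) ((γ z s i).2, (γ z s j).2); let Kc := fun (Fn : Literature.Analysis.FluidPDE.Config (N + 1) (Fin 3) Literature.MathematicalPhysics.KineticTheory.T3 → ℝ → Fin (N + 1) → Fin (N + 1) → ℝ) z => ε / (N + 1 : ℝ) * ∑ᶠ (s : ℝ) (_ : s ∈ Literature.Analysis.FluidPDE.collisionTimes G ε (γ z) ∩ Set.Icc 0 τ), ∑ i : Fin (N + 1), ∑ j : Fin (N + 1), (if i ≠ j ∧ ‖G.sepVec (γ z s i).1 (γ z s j).1‖ = ε then Fn z s i j else 0); Literature.MathematicalPhysics.KineticTheory.localGibbsLaw σ a₀ u₀ θ₀ N (Φ N) {z | Kc (fun z s i j => χ (s, (γ z s i).1) * Ξ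 (ε⁻¹ • G.sepVec (γ z s i).1 (γ z s j).1, (pv z s i j).1, (pv z s i j).2)) z < g₀ * σ ^ 3 * (∫ s in Set.Icc (0 : ℝ) τ, ∫ x : UnitAddTorus (Fin 3), χ (s, x) * B Ξ z s x) - η} ≤ ENNReal.ofReal δ

/-- `0 < η` is load-bearing: without it take `η = -1`, `χ = 0`, `Ξ = 0`; both functionals vanish, the event
`{0 < 0 - (-1)}` is the whole space and has local-Gibbs probability `1 > 1/2 = δ`.  (Profiles `(1, 1, 0)`,
`σ = min (σ₀/2) (1/4)`, flows from Alexander's theorem `HardSphereFlow.nonempty_torus_holds`.) [folklore] -/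
theorem rateFloor_false_without_etaPos : ¬ RateFloorWithoutEtaPos := by
  rintro ⟨g₀, -, h⟩
  obtain ⟨σ₀, hσ₀, h⟩ := h (fun _ => 1) (fun _ => 1) (fun _ => 0) continuous_const continuous_const
    continuous_const (fun _ => one_pos) (fun _ => one_pos)
  set σ : ℝ := min (σ₀ / 2) (1 / 4) with hσdef
  have hσpos : 0 < σ := lt_min (by linarith) (by norm_num)
  have hσlt : σ < σ₀ := (min_le_left _ _).trans_lt (by linarith)
  have hσhalf : σ ≤ 1 / 2 := (min_le_right _ _).trans (by norm_num)
  have hσlt2 : σ < 2⁻¹ := (min_le_right _ _).trans_lt (by norm_num)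
  have hΦ : ∀ N : ℕ, Nonempty (HardSphereFlow (Torus.geometry (Fin 3)) (hsDiameter σ N) (N + 1)) :=
    fun N => HardSphereFlow.nonempty_torus_holds (hsDiameter_pos hσpos N)
      ((hsDiameter_le hσpos.le N).trans_lt hσlt2) (N + 1)
  obtain ⟨r₀, hr₀, h⟩ := h σ hσpos hσlt (fun N => (hΦ N).some) 1 one_pos (fun _ => 0) continuous_const
    (fun _ => le_rfl) (fun _ => 0) continuous_const (fun _ => le_rfl) ⟨0, fun _ => le_rfl⟩ (-1) (1 / 2)
    (by norm_num)
  obtain ⟨N₀, h⟩ := h (r₀ / 2) (by linarith) (by linarith)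
  have h := h N₀ le_rfl
  haveI := isProbabilityMeasure_localGibbsLaw (a₀ := fun _ => (1 : ℝ)) (θ₀ := fun _ => (1 : ℝ))
    (u₀ := fun _ => (0 : V3)) continuous_const continuous_const continuous_const (fun _ => one_pos)
    (fun _ => one_pos) hσhalf N₀ ((hΦ N₀).some)
  simp only [zero_mul, ite_self, Finset.sum_const_zero, finsum_zero, mul_zero, integral_zero,
    sub_neg_eq_add, zero_add, zero_lt_one, setOf_true, measure_univ] at h
  have h1 : (1 : ℝ≥0∞) ≤ ENNReal.ofReal (1 / 2) := h
  rw [ENNReal.one_le_ofReal] at h1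
  norm_num at h1

/-! ## §4 Quantifier order `r` before `N`: with `r` after `N` the pair functional vanishes identically -/

/-- Pointwise core of the junk-truth of the order-swapped variant: on the hard-sphere domain two DISTINCT
centres are `≥ ε` apart, so if `2r < ε` they cannot both lie within `r` of the same `x₀`; hence the product
of cone weights `bx(x_i,x₀)·bx(x_j,x₀)` vanishes for `i ≠ j` (and the diagonal has `Θ^Ξ(v,v) = 0`,
`hardSphereKernel_self`).  So `B^Ξ_r ≡ 0`, the right-hand side is `−η < 0 ≤ K_N`, and the event is empty:
a `RateFloor` with `∃ r₀` moved after `∀ N` would be TRUE for the wrong reason.  The filed order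
(`r` fixed as `N → ∞`, so `ε_N = σ(N+1)^{-1/3} ≪ r` eventually) is the meaningful one. [folklore] -/
theorem bxProd_eq_zero_of_sep {ε r : ℝ} (hr : 0 < r) (h2r : 2 * r < ε) {x y : T3}
    (hxy : ε ≤ Torus.euclidDist x y) (x₀ : T3) :
    (3 / (Real.pi * r ^ 3) * max (1 - Torus.euclidDist x x₀ / r) 0) *
      (3 / (Real.pi * r ^ 3) * max (1 - Torus.euclidDist y x₀ / r) 0) = 0 := by
  by_contra hne
  have hx : Torus.euclidDist x x₀ < r := by
    by_contra hx
    apply hne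
    have : max (1 - Torus.euclidDist x x₀ / r) 0 = 0 :=
      max_eq_right (by rw [sub_nonpos, le_div_iff₀ hr, one_mul]; exact not_lt.mp hx)
    rw [this]; ring
  have hy : Torus.euclidDist y x₀ < r := by
    by_contra hy
    apply hne
    have : max (1 - Torus.euclidDist y x₀ / r) 0 = 0 :=
      max_eq_right (by rw [sub_nonpos, le_div_iff₀ hr, one_mul]; exact not_lt.mp hy)
    rw [this]; ring
  have htri := Torus.euclidDist_triangle x x₀ y
  rw [Torus.euclidDist_comm x₀ y] at htri
  linarith

/-- Integration against the product of an empirical measure with itself only sees the atoms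
`(z i, z j)`: a function vanishing on all of them integrates to `0` (the off-atom set is null for each
factor, `Measure.prod_prod_le`). [folklore] -/
theorem integral_prod_empiricalMeasure_eq_zero {N : ℕ} (z : Config (N + 1) (Fin 3) T3)
    (f : (T3 × V3) × (T3 × V3) → ℝ) (hf : ∀ i j, f (z i, z j) = 0) :
    ∫ p, f p ∂((empiricalMeasure z).prod (empiricalMeasure z)) = 0 := by
  set μ := empiricalMeasure z with hμ
  set A : Set (T3 × V3) := Set.range z with hA
  have hAm : MeasurableSet A := (Set.finite_range z).measurableSet
  have hμA : μ Aᶜ = 0 := by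
    rw [hμ, empiricalMeasure_eq, Measure.smul_apply, Measure.coe_finsetSum, Finset.sum_apply,
      Finset.sum_eq_zero, smul_zero]
    intro i _
    rw [Measure.dirac_apply' _ hAm.compl, Set.indicator_of_notMem]
    exact fun h => h ⟨i, rfl⟩
  have h1 : (μ.prod μ) (Aᶜ ×ˢ (univ : Set (T3 × V3))) = 0 :=
    le_antisymm ((Measure.prod_prod_le _ _).trans (by rw [hμA, zero_mul])) zero_le
  have h2 : (μ.prod μ) ((univ : Set (T3 × V3)) ×ˢ Aᶜ) = 0 :=
    le_antisymm ((Measure.prod_prod_le _ _).trans (by rw [hμA, mul_zero])) zero_le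
  refine integral_eq_zero_of_ae ?_
  rw [Filter.EventuallyEq, ae_iff]
  refine measure_mono_null (fun p hp => ?_) (measure_union_null h1 h2)
  simp only [Set.mem_setOf_eq, Pi.zero_apply] at hp
  by_contra hne
  simp only [Set.mem_union, Set.mem_prod, Set.mem_univ, and_true, true_and, Set.mem_compl_iff, not_or,
    not_not, hA, Set.mem_range] at hne
  obtain ⟨⟨i, hi⟩, ⟨j, hj⟩⟩ := hne
  apply hp
  have : p = (z i, z j) := Prod.ext hi.symm hj.symm
  rw [this]
  exact hf i j

/-- `RateFloor` with `∃ r₀` moved AFTER `∀ N ≥ N₀` (so that the mollification scale may shrink with `N`);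
everything else verbatim. [folklore] -/
def RateFloorRAfterN : Prop :=
  ∃ g₀ : ℝ, 0 < g₀ ∧ ∀ (a₀ θ₀ : Literature.MathematicalPhysics.KineticTheory.T3 → ℝ) (u₀ : Literature.MathematicalPhysics.KineticTheory.T3 → Literature.MathematicalPhysics.KineticTheory.V3), Continuous a₀ → Continuous θ₀ → Continuous u₀ → (∀ x, 0 < a₀ x) → (∀ x, 0 < θ₀ x) → ∃ σ₀ : ℝ, 0 < σ₀ ∧ ∀ σ : ℝ, 0 < σ → σ < σ₀ → ∀ Φ : (N : ℕ) → Literature.Analysis.FluidPDE.HardSphereFlow (Literature.Analysis.FluidPDE.Torus.geometry (Fin 3)) (Literature.MathematicalPhysics.KineticTheory.hsDiameter σ N) (N + 1), ∀ τ : ℝ, 0 < τ → ∀ χ : ℝ × UnitAddTorus (Fin 3) → ℝ, Continuous χ → (∀ p, 0 ≤ χ p) → ∀ Ξ : EuclideanSpace ℝ (Fin 3) × EuclideanSpace ℝ (Fin 3) × EuclideanSpace ℝ (Fin 3) → ℝ, Continuous Ξ → (∀ q, 0 ≤ Ξ q) → (∃ C : ℝ, ∀ q, Ξ q ≤ C)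 → ∀ η δ : ℝ, 0 < η → 0 < δ → ∃ N₀ : ℕ, ∀ N : ℕ, N₀ ≤ N → ∃ r₀ : ℝ, 0 < r₀ ∧ ∀ r : ℝ, 0 < r → r < r₀ → let ε := Literature.MathematicalPhysics.KineticTheory.hsDiameter σ N; let G := Literature.Analysis.FluidPDE.Torus.geometry (Fin 3); let γ := fun z (s : ℝ) => (Φ N).flow s z; let bx : UnitAddTorus (Fin 3) → UnitAddTorus (Fin 3) → ℝ := fun x y => 3 / (Real.pi * r ^ 3) * max (1 - Literature.Analysis.FluidPDE.Torus.euclidDist x y / r) 0; let Θ := fun (Ξ : EuclideanSpace ℝ (Fin 3) × EuclideanSpace ℝ (Fin 3) × EuclideanSpace ℝ (Fin 3) → ℝ) (v w : EuclideanSpace ℝ (Fin 3)) => ∫ ω : Metric.sphere (0 : EuclideanSpace ℝ (Fin 3)) 1, Ξ ((ω : EuclideanSpace ℝ (Fin 3)), v, w) * Literature.MathematicalPhysics.KineticTheory.hardSphereKernel (w, v) ω ∂Literature.MathematicalPhysics.KineticTheory.sphereMeasure; let B := fun Ξ z s (x₀ : UnitAddTorus (Fin 3)) => ∫ p, bx p.1.1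 x₀ * bx p.2.1 x₀ * Θ Ξ p.1.2 p.2.2 ∂((Literature.Analysis.FluidPDE.empiricalMeasure (γ z s)).prod (Literature.Analysis.FluidPDE.empiricalMeasure (γ z s))); let pv := fun z s (i j : Fin (N + 1)) => Literature.Analysis.FluidPDE.reflectVel (G.sepVec (γ z s i).1 (γ z s j).1) ((γ z s i).2, (γ z s j).2); let Kc := fun (Fn : Literature.Analysis.FluidPDE.Config (N + 1) (Fin 3) Literature.MathematicalPhysics.KineticTheory.T3 → ℝ → Fin (N + 1) → Fin (N + 1) → ℝ) z => ε / (N + 1 : ℝ) * ∑ᶠ (s : ℝ) (_ : s ∈ Literature.Analysis.FluidPDE.collisionTimes G ε (γ z) ∩ Set.Icc 0 τ), ∑ i : Fin (N + 1), ∑ j : Fin (N + 1), (if i ≠ j ∧ ‖G.sepVec (γ z s i).1 (γ z s j).1‖ = ε then Fn z s i j else 0); Literature.MathematicalPhysics.KineticTheory.localGibbsLaw σ a₀ u₀ θ₀ N (Φ N) {z | Kc (fun z s i j => χ (s, (γ z s i).1) * Ξ (ε⁻¹ • G.sepVec (γ z s i).1 (γ z s j).1, (pv z s i j).1, (pv z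 s i j).2)) z < g₀ * σ ^ 3 * (∫ s in Set.Icc (0 : ℝ) τ, ∫ x : UnitAddTorus (Fin 3), χ (s, x) * B Ξ z s x) - η} ≤ ENNReal.ofReal δ

/-- The order-swapped variant is TRUE FOR THE WRONG REASON (junk truth, no dynamics): with `r₀ := ε_N/2`
the pair functional `B^Ξ_r` vanishes identically along every good trajectory (hard-sphere exclusion +
`Θ^Ξ(v,v) = 0`), the right-hand side is `−η < 0 ≤ K_N`, the event is contained in the Liouville-null bad
set of the flow, and the local Gibbs law is absolutely continuous.  Moral for planners/provers: the filed
order `∃ r₀ ∀ r ∃ N₀ ∀ N` (`ε_N ≪ r`) is exactly what gives `RateFloor` content; any proof that never uses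
`ε_N < 2r` is suspicious. [folklore] -/
theorem rateFloorRAfterN_holds : RateFloorRAfterN := by
  refine ⟨1, one_pos, ?_⟩
  intro a₀ θ₀ u₀ _ _ _ _ _
  refine ⟨4⁻¹, by norm_num, ?_⟩
  intro σ hσ _ Φ τ _ χ _ hχ0 Ξ _ hΞ0 _ η δ hη _
  refine ⟨0, fun N _ => ⟨hsDiameter σ N / 2, half_pos (hsDiameter_pos hσ N), ?_⟩⟩
  intro r hr hrlt ε G γ bx Θ B pv Kc
  have hε : 0 < ε := hsDiameter_pos hσ N
  have h2r : 2 * r < ε := by show 2 * r < hsDiameter σ N; linarith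
  have hgood : localGibbsLaw σ a₀ u₀ θ₀ N (Φ N) (Φ N).goodᶜ = 0 := by
    rw [localGibbsLaw, particleLaw_eq]
    exact withDensity_absolutelyContinuous _ _ (Φ N).measure_compl_good
  refine (measure_mono ?_).trans (hgood.le.trans zero_le)
  intro z hz hzg
  simp only [Set.mem_setOf_eq] at hz
  have hB : ∀ s x₀, B Ξ z s x₀ = 0 := by
    intro s x₀
    show ∫ p, bx p.1.1 x₀ * bx p.2.1 x₀ * Θ Ξ p.1.2 p.2.2
      ∂((empiricalMeasure (γ z s)).prod (empiricalMeasure (γ z s))) = 0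
    apply integral_prod_empiricalMeasure_eq_zero
    intro i j
    by_cases hij : i = j
    · subst hij
      have hΘ : Θ Ξ (γ z s i).2 (γ z s i).2 = 0 := by
        show ∫ ω, Ξ ((ω : V3), (γ z s i).2, (γ z s i).2) *
          hardSphereKernel ((γ z s i).2, (γ z s i).2) ω ∂sphereMeasure = 0
        simp [hardSphereKernel_self]
      show bx (γ z s i).1 x₀ * bx (γ z s i).1 x₀ * Θ Ξ (γ z s i).2 (γ z s i).2 = 0
      rw [hΘ, mul_zero]
    · have hmem : γ z s ∈ hardSphereDomain G (N + 1) ε := ((Φ N).isTrajectory z hzg).mem s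
      have hsep : ε ≤ Torus.euclidDist (γ z s i).1 (γ z s j).1 := hmem i j hij
      have h0 := bxProd_eq_zero_of_sep hr h2r hsep x₀
      show bx (γ z s i).1 x₀ * bx (γ z s j).1 x₀ * Θ Ξ (γ z s i).2 (γ z s j).2 = 0
      rw [show bx (γ z s i).1 x₀ * bx (γ z s j).1 x₀ = 0 from h0, zero_mul]
  have hI : (∫ s in Set.Icc (0 : ℝ) τ, ∫ x : UnitAddTorus (Fin 3), χ (s, x) * B Ξ z s x) = 0 := by
    simp [hB]
  have hK : 0 ≤ Kc (fun z s i j => χ (s, (γ z s i).1) *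
      Ξ (ε⁻¹ • G.sepVec (γ z s i).1 (γ z s j).1, (pv z s i j).1, (pv z s i j).2)) z := by
    refine mul_nonneg (div_nonneg hε.le (by positivity)) (finsum_nonneg fun s => finsum_nonneg fun _ =>
      Finset.sum_nonneg fun i _ => Finset.sum_nonneg fun j _ => ?_)
    split_ifs
    · exact mul_nonneg (hχ0 _) (hΞ0 _)
    · exact le_rfl
  rw [hI, mul_zero, zero_sub] at hz
  linarith

/-! ## §6 Why it resists — and what a proof would actually need (briefing for provers)

* NEAREST RIGOROUS FACT (equilibrium, exact): for CONSTANT profiles the local Gibbs law is flow-invariant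
  (Liouville + energy conservation), and for a measure-preserving flow with the collision boundary as
  cross-section the Ambrose–Kakutani / Santaló ("Kac flux") formula gives the expectation of any additive
  collision functional exactly: `E[K_N[Ξ]] = τ · (ε/(N+1)) · Σ_{i≠j} ∫_{contact, incoming} Ξ · ((w−v)·n̂)₊ dμ_N^{surface}`,
  i.e. the Enskog value with the finite-`N` canonical contact density (→ `Y(ρσ³) ≥ 1`).  So in global equilibrium
  the MEAN of `K_N[χΞ]` already exceeds `σ³∫χB^Ξ` for every mark; a violation of `RateFloor` there would have to
  be a failure of CONCENTRATION of an additive functional of `≍ (N+1)^{4/3} σ² τ` collision events (weights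
  `ε/(N+1)`), not a rate deficit.  Neither the concentration nor any pathwise lower bound on collision counts
  along the deterministic many-body flow is in print (upper bounds only: Vaserstein 1979 CMP 69, Illner 1989
  TTSP 18, Burago–Ferleger–Kononenko 1998 Ann. Math. 147; the flux/mean-free-path identity for billiard flows:
  Chernov 1997 J. Stat. Phys. 88, Chernov–Markarian *Chaotic Billiards* §2.12–2.13 — refs recalled, `lit search`
  was down (rc 75) throughout this cycle) — this is why the item is harder than its `[difficulty: L]` tag and
  also why no refutation is within reach: killing it needs the same control, with the opposite sign.
* OUT OF EQUILIBRIUM the pre-collisional contact law deviates from `Y·f⊗f` only through dynamical correlations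
  (rings/recollisions), which are `O(φ)` in amplitude AND proportional to the local deviation from equilibrium,
  `O(Kn)`, `Kn ≍ (N+1)^{-1/3}` at fixed `σ` — the planner's "screening of slow pairs" has no equilibrium
  component at all: static Gibbs factorisation `f⁽²⁾_eq = f_eq ⊗ f_eq · g(r₁−r₂)` with `g` velocity-independent
  is exact (Soto 2016 §4.8.1 (4.85)–(4.86), pp. 122–123, held: `book:soto2016-kinetic-theory-transport-phenomena`),
  so on the incoming hemisphere the contact law is `χ·f⊗f` pointwise in `(n̂,v,w)`.  Out of equilibrium the
  factorised average "neglects all velocity correlations", the Enskog level adds those "generated by the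
  collision" (post-collisional), and what both neglect are "correlations that persist for more than one
  collision" (Lutsko 2001, arXiv:cond-mat/0008359 p. 4, doi:10.1103/physrevlett.86.3344); in uniform shear the
  contact pdf is `χ(1 + A r̂_x r̂_y)` with `A` set by the shear rate in collision units (ibid. p. 5, Lutsko 1996)
  — a `Kn = O(1)` effect, J-even in the angle, vanishing in the crux's Euler scaling.
* MOLLIFICATION works FOR the floor in the density slot (Jensen: `(bx*ρ)² ≤ bx*ρ²`, so `∫χ(bx*ρ)² ≤ ∫(bx*χ)ρ²`)
  and only mildly against it in the velocity slot (pairs `2r` apart see `|u(x)−u(y)| ≤ 2r‖∇u‖`, absorbed by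
  `r₀` chosen after the profiles and by `η`; after shocks the straddling pairs occupy an `O(r)` volume fraction).
* STAKES: the glue consumes `RateFloor` only through ParityRigidity, which needs an a.e.-POSITIVE floor, not a
  uniform one; a velocity-dependent `g₀(|g|, n̂) > 0` restatement (planner's own fallback) would survive even a
  hypothetical slow-pair screening.  So the uniform constant is a convenience, and the cheapest meaningful test of
  the line remains OddContactSymmetry, not this item.
-/

/-! ## §5 Computation log (kit jobs)

* `j007921` — smoke test of the EDMD panel (N = 300): exit 0, pipeline validated.
* `j009144` — FULL PANEL (exit 0; evidence `compute-j009144.json` + `EDMD-panel-summary.md` on the item).  Event-driven MD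
  of `N` hard spheres in the unit 3-torus from local-Gibbs data (equilibrated uniform positions; `v_i = u₀(x_i) + √θ₀(x_i) ξ_i`),
  40 runs, 1 520 800 collisions: `φ ∈ {0.05, 0.2}`, `N ∈ {2000, 6000}`, profiles = equilibrium / shear wave (Mach ≈ 1.5) /
  temperature wave (`θ ∈ [0.3, 1.7]`) / converging streams (`u_y = A sin 2πy`, `A ∈ {1.5, 3}` thermal speeds: two colliding
  jets, density compression up to `×1.65`) / hot–cold colliding streams; `Kn ≈ 0.05–0.13`; mollifier `r = 0.08`, `χ ≡ 1`.
  Measured `R = K_N[Ξ_{kl}] / (σ³ ∫₀^τ∫ B^{Ξ_{kl}}_r)` over the 7 × 4 panel of marks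
  `Ξ_{kl} = 1{|w−v| ∈ G_k} 1{(w−v)·n̂/|w−v| ∈ B_l}` (slow pairs `|g| < 0.5√θ` and grazing `b < 0.3` included), per quarter-time
  window and per `y`-slab.  RESULTS: `R/Y(φ)` is FLAT over all velocity and angle bins in every run — per-group spread `±5 %`
  (`±20 %` in the sparsely populated slowest bin); slow pairs pooled: `R/Y = 1.11 / 1.05 / 1.41` (φ=.05 N=2000 / N=6000 / φ=.2),
  identical to the other bins; lowest bin anywhere with ≥ 200 collisions `R/Y = 0.971` (an EQUILIBRIUM run — counting noise),
  lowest time window `0.996`, lowest slab×bin `0.885·Y = 1.01` absolute (compression slab).  Absolute level `R_tot/Y = 1.04`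
  at `(ε/r)³ = .031`, `1.11–1.16` at `.093`, `1.34–1.43` at `.37`: the hard-core hole under the mollifier (pairs closer than
  `ε` are absent from `B`), `≈ +1.6(ε/r)³`, which only RAISES `R` and vanishes in the crux's regime `ε_N ≪ r`; non-equilibrium
  raises `R` slightly (compression ⇒ larger local `Y`).  Energy conserved to `1e-16`, zero stale events.
  VERDICT: no velocity- or geometry-dependent suppression of the pre-collisional contact rate below the ideal value in any
  local-Gibbs evolution probed; a uniform `g₀ = 1/2` holds with a factor `≥ 2` margin in all 28 bins × 4 windows × 4 slabs
  of all 40 runs.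
* `j013767` — FOLLOW-UP (exit 0; 8 runs, 820 485 collisions; evidence `compute-j013767.json`): `φ = 0.2` at `N = 6000`,
  `r = 0.1` (`(ε/r)³ = .064`): `R_tot/Y = 1.056` (equilibrium, 2 seeds), `1.048` (shear Mach 1.5), `1.157` (colliding streams
  `A = 3`, compression ⇒ larger local `Y`); per-|g|-bin `R/Y ∈ [1.01, 1.24]`, per-angle-bin spread `< 1 %`, worst bin with
  ≥ 200 collisions `0.980`, worst quarter-window `1.001`; `φ = 0.05`, `N = 6000` (`(ε/r)³ = .016`): temperature wave `1.032`,
  hot–cold colliding streams `1.077`.  Confirms the panel: the absolute level converges to `Y(φ)` FROM ABOVE as `ε/r → 0`, and no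
  bin, window or slab of any run falls below `0.98·Y` (slab minima `0.90–0.95·Y`, i.e. `≥ 1.0` absolute).
* gate: p73162 ACCEPTED = `Theorems/RateFloor/Negative/WithoutEtaPos.lean` (§3, commit 89c832de3396);
  p73513 ACCEPTED = `Theorems/RateFloor/Negative/RAfterN.lean` (§4, commit 4378230c8f57).  Provers may import them.
-/

end Summit.AtomisticToContinuum.HydrodynamicLimit.Cruxes.RateFloor.Disproof
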